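import Literature.NumberTheory.GaloisRepresentations.CubicEisensteinRamificationProofs
import HarnessLib

/-!
# Valuations in a power basis: `v_𝔓(Σ c_k ϖ^k) = min_k (e·v_𝔭(c_k) + k)`

`Proofs` file (theorems only, no definitions, no named facts) in topic
`NumberTheory/GaloisRepresentations`, landed by the seat of bsd.S15
(`Literature.NumberTheory.EllipticCurves.conductorNorm_eq_artinConductorNat_of_isElliptic`) as the
arithmetic normal form used to read valuations off coefficients in an explicit totally ramified
field `K₀(ϖ)` (`ϖ` a uniformizer, e.g. a root of an Eisenstein polynomial of degree `e`): the
terms `c_k ϖ^k`, `0 ≤ k < e`, have valuations `e·v(c_k) + k`, pairwise distinct modulo `e`, so no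
two of them cancel and the valuation of the sum is the least of them (Serre, *Local Fields*,
Ch. I §6, Prop. 17–18: `𝒪_L = 𝒪_K[ϖ]` and `v_L(Σ c_k ϖ^k) = min (e v_K(c_k) + k)`).

* `ord_add_eq_min_of_ne` — `v(x + y) = min (v x) (v y)` if `v x ≠ v y`;
* `ord_sum_eq_inf_of_forall_ne` — `v(Σ_{i ∈ s} t_i) = inf_{i ∈ s} v(t_i)` if the non-zero terms
  have pairwise distinct valuations;
* `ord_sum_mul_pow_eq_inf` — **`v_𝔓(Σ_{k<n} f(c_k) ϖ^k) = inf_{k<n} (e·w(c_k) + k)`** for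
  `v_𝔓(ϖ) = 1`, a ring map `f` with `v_𝔓(f c) = e·w(c)` (e.g. `algebraMap R S` with
  `e = e(𝔓 ∣ 𝔭)`, `ord_algebraMap`) and `n ≤ e`.

## References

* J.-P. Serre, *Local Fields*, GTM 67 (1979), Ch. I §6 Prop. 17, 18; Ch. II §1.
  [SerreLocalFields1979]

## Design

Theorems only, `namespace Literature.NumberTheory.GaloisRepresentations`, for any Dedekind domain
`B` and prime `P` (the tree's `ord : B → ℕ∞`).  Axioms: `propext`, `Classical.choice`,
`Quot.sound`.
-/

noncomputable section

open scoped Classical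

namespace Literature.NumberTheory.GaloisRepresentations

variable {B : Type*} [CommRing B] [IsDedekindDomain B] (P : Ideal B)

/-- `v(x + y) = min (v x) (v y)` when `v x ≠ v y` (ultrametric domination, both orders).
[cite: SerreLocalFields1979, Ch. II §1] -/
theorem ord_add_eq_min_of_ne {x y : B} (h : ord P x ≠ ord P y) :
    ord P (x + y) = min (ord P x) (ord P y) := by
  rcases lt_or_gt_of_ne h with hlt | hlt
  · rw [add_comm, ord_add_eq_of_lt P hlt, min_eq_left hlt.le]
  · rw [ord_add_eq_of_lt P hlt, min_eq_right hlt.le]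

/-- **No cancellation among terms of pairwise distinct valuations**: if the non-zero terms `t_i`,
`i ∈ s`, have pairwise distinct `v_𝔓`, then `v_𝔓(Σ_{i∈s} t_i) = inf_{i∈s} v_𝔓(t_i)` (`𝔓 ≠ 0`
prime). [cite: SerreLocalFields1979, Ch. II §1] -/
theorem ord_sum_eq_inf_of_forall_ne [P.IsPrime] (hP : P ≠ ⊥) {ι : Type*} (s : Finset ι)
    (t : ι → B)
    (h : ∀ i ∈ s, ∀ j ∈ s, i ≠ j → t i ≠ 0 → t j ≠ 0 → ord P (t i) ≠ ord P (t j)) :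
    ord P (∑ i ∈ s, t i) = s.inf fun i ↦ ord P (t i) := by
  induction s using Finset.induction_on with
  | empty => simp [ord_zero]
  | @insert a s ha ih =>
    have h' : ∀ i ∈ s, ∀ j ∈ s, i ≠ j → t i ≠ 0 → t j ≠ 0 → ord P (t i) ≠ ord P (t j) :=
      fun i hi j hj ↦ h i (Finset.mem_insert_of_mem hi) j (Finset.mem_insert_of_mem hj)
    rw [Finset.sum_insert ha, Finset.inf_insert, ← ih h']
    by_cases hne : ord P (t a) ≠ ord P (∑ i ∈ s, t i)
    · exact ord_add_eq_min_of_ne P hne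
    · rw [not_not] at hne
      -- equal valuations: both are `⊤` (else the infimum over `s` is attained at some `j ≠ a`)
      by_cases hta : t a = 0
      · rw [hta, zero_add, ord_zero, min_eq_right le_top]
      · exfalso
        obtain ⟨k, hk⟩ := exists_ord_eq_natCast P hP hta
        have hinf : (s.inf fun i ↦ ord P (t i)) = k := by rw [← ih h', ← hne, hk]
        -- the infimum is attained
        have hsne : s.Nonempty := by
          by_contra hs
          rw [Finset.not_nonempty_iff_eq_empty] at hs
          rw [hs, Finset.inf_empty] at hinf
          exact ENat.top_ne_coe k hinf
        obtain ⟨j, hj, hjmin⟩ := Finset.exists_mem_eq_inf s hsne fun i ↦ ord P (t i)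
        rw [hjmin] at hinf
        have htj : t j ≠ 0 := by
          intro h0; rw [h0, ord_zero] at hinf; exact ENat.top_ne_coe k hinf
        have haj : a ≠ j := fun e ↦ ha (e ▸ hj)
        exact h a (Finset.mem_insert_self a s) j (Finset.mem_insert_of_mem hj) haj hta htj
          (by rw [hk, hinf])

/-- **Valuation in a power basis of a uniformizer.**  Let `v_𝔓(ϖ) = 1` (`𝔓 ≠ 0` prime) and let
`f : R → B` be a ring homomorphism with `v_𝔓(f c) = e · w(c)` for all `c` (e.g. the structure map
of a ring of integers below, `e = e(𝔓 ∣ 𝔭)`, `w = v_𝔭`: `ord_algebraMap`).  Then for `n ≤ e`,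
**`v_𝔓(Σ_{k<n} f(c_k) ϖ^k) = inf_{k<n} (e·w(c_k) + k)`**: the terms have valuations pairwise
incongruent modulo `e`.  This is how valuations are read off coefficients in `𝒪_K[ϖ] = 𝒪_L` for a
totally ramified `L = K(ϖ)` (Serre I §6 Prop. 18).
[cite: SerreLocalFields1979, Ch. I §6 Prop. 17 and Prop. 18] -/
theorem ord_sum_mul_pow_eq_inf [P.IsPrime] (hP : P ≠ ⊥) {R : Type*} [CommRing R] (f : R →+* B)
    {e : ℕ} {w : R → ℕ∞} (hf : ∀ c : R, ord P (f c) = e * w c) {ϖ : B} (hϖ : ord P ϖ = 1)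
    {n : ℕ} (hn : n ≤ e) (c : ℕ → R) :
    ord P (∑ k ∈ Finset.range n, f (c k) * ϖ ^ k) =
      (Finset.range n).inf fun k ↦ (e : ℕ∞) * w (c k) + k := by
  have hterm : ∀ k, ord P (f (c k) * ϖ ^ k) = (e : ℕ∞) * w (c k) + k := by
    intro k
    rw [ord_mul P hP, ord_pow P hP, hf, hϖ, mul_one]
  rw [ord_sum_eq_inf_of_forall_ne P hP (Finset.range n) (fun k ↦ f (c k) * ϖ ^ k) ?_]
  · exact Finset.inf_congr rfl fun k _ ↦ hterm k
  intro i hi j hj hij hti htj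
  rw [hterm, hterm]
  rw [Finset.mem_range] at hi hj
  have he0 : (e : ℕ∞) ≠ 0 := by exact_mod_cast (show e ≠ 0 by omega)
  -- finite values of `w` at non-zero terms
  have hfin : ∀ k, f (c k) * ϖ ^ k ≠ 0 → ∃ a : ℕ, w (c k) = a := by
    intro k htk
    have h1 : (e : ℕ∞) * w (c k) + k ≠ ⊤ := by rw [← hterm]; exact ord_ne_top P hP htk
    have h2 : w (c k) ≠ ⊤ := fun h0 ↦ h1 (by rw [h0, ENat.mul_top he0, top_add])
    exact ENat.ne_top_iff_exists.mp h2 |>.imp fun _ h ↦ h.symm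
  obtain ⟨a, ha⟩ := hfin i hti
  obtain ⟨b, hb⟩ := hfin j htj
  rw [ha, hb]
  intro heq
  have heq' : e * a + i = e * b + j := by exact_mod_cast heq
  -- reduce modulo `e`: `i ≡ j`, with `i, j < e`
  have hmod : i % e = j % e := by
    have := congrArg (· % e) heq'
    simpa [Nat.add_mod, Nat.mul_mod_right] using this
  rw [Nat.mod_eq_of_lt (by omega), Nat.mod_eq_of_lt (by omega)] at hmod
  exact hij hmod

end Literature.NumberTheory.GaloisRepresentations

end
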